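/-
Copyright (c) 2026 the pub-hodgecm-mathlib formalisation cell (harness21).  Prover seat hodgecm-mathlib-K2Liu-p26 (g2): Track B «K2-LIT»,
#184♮ = hLiu418 = stmt-HodgeConjecture-24832; #42S organ S1, (G) organ ROW (ρ-mid), step (M2a-C3-c″): THE `κ`-ROWS OF THE INTEGRATION POINT AND OF ITS LEVI
TRANSLATE — ★ (C3-e) `K2LiuTensorMiddleCellPointReading` ∘ the witness letter (K1) ∘ ★ (C3-c) `K2LiuTensorMiddleCellFrameReading` (K2E1-p10 (g4) 22:37:39Z «second half:
p26 inlines it — his call»).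
-/
import Summits.HodgeConjecture.HodgeConjecture.Theorems.K2LiuTensorMiddleCellPointReading   -- ★∕📤 (C3-e) `exists_pointReading`
import Summits.HodgeConjecture.HodgeConjecture.Theorems.K2LiuTensorMiddleCellFrameReading   -- ★ (C3-c) `kappa_inv_levi_of_single_row` (K2E1-p10)
import HarnessLib

/-!
# Crux `HLiu418`, #42S organ S1, (G) organ ROW (ρ-mid), step (M2a-C3-c″): THE `κ`-ROWS OF THE INTEGRATION POINT `z = PD·(x₁ ⊔ 0)` AND OF `B⁻¹·z`

Cell `hodgecm-mathlib`, crux item hLiu418 = `stmt-HodgeConjecture-24832`, route of record `HCCMUnconditional`; squad K2 ∕ K2Liu, road `K2_Liu`, socket #42S (a),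
organ S1; LEAD F0P6-plan (g14); (M2a) chain ★ (C1) → ★ (C2b′) → ★ (C3) p862499 → {★ (C3-b) p862528, ★ (C3-c) p862594, (C3-e) p862649} → THIS FILE → evaluation
(F0P2-p07 (g0) `K2LiuNonsplitMiddleProfileRow` 📤 p862456, K2Liu-p08 (g5) split).  THEOREMS ONLY (no `def`, no `instance`, no `notation`, no named-fact hypothesis,
no `sorry`); lane `--supports stmt-HodgeConjecture-24832` (count-neutral helper).

WHAT.  ★ (C3-e) computes the (K1)-READING of the integration point: `R z j l = [j = i₀] · cX(x₁)_l`.  The witness packages speak through the frame coordinate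
`κ : X → (E_{w₀}²)³` tied to the reading by the letter (K1) `![(κ x).1 j, (κ x).2.1 j, (κ x).2.2 j] ᵥ* P₃ = fun l => R x j l (w₀)` (`P₃` invertible).  Hence:
* §1 (pure algebra) **`single_rows_of_reading`** — if row `j` of the reading of `z` is `[j = i₀] · c`, then each coordinate vector of `κ z` is a multiple of
  `e_{i₀}`: `(κ z).b = ((c ᵥ* P₃⁻¹) b) • Pi.single i₀ 1` — the `hz` letter of ★ (C3-c) `kappa_inv_levi_of_single_row`.
* §2 (tensor datum, `M₂ = 3`) **`exists_pointRows`** — ★ (C3-e) `exists_pointReading` + §1: ONE linear homeomorphism `cX : X₁ ≃L[F_v] (E ⊗ F_v)³` with, for every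
  `x₁`, `(κ (PD·(x₁ ⊔ 0))).1 = α(x₁) • e_{i₀}`, `.2.1 = β(x₁) • e_{i₀}`, `.2.2 = γ(x₁) • e_{i₀}`, `(α, β, γ)(x₁) := ((fun l => cX x₁ l w₀) ᵥ* P₃⁻¹)`; and
  **`exists_pointRows_levi`** — composed with ★ (C3-c): for every Siegel `k` and Levi letter `hB` (★ (C3-b) supplies `⟨B, hB⟩`),
  `(κ (B⁻¹ · PD·(x₁ ⊔ 0))).1 = fun j => α(x₁) · (blkD (matA k⁻¹) j i₀)(w₀)` (and `.2.1`, `.2.2` with `β, γ`) — EXACTLY the Levi-row shape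
  `(fun j => α * a j, fun j => β * a j, fun j => γ * a j)` consumed by ★ (M2a-L)ϖ `K2LiuWitnessLeviReadingUniformizer.indicator_boxOne_sub_boxTwo_levi` and by
  F0P2-p07's `K2LiuNonsplitMiddleProfileRow` (`a j := (blkD (matA k⁻¹) j i₀)(w₀)`).
References: [Kudla1994] §2, §3 Thm. 3.1; [HarrisKudlaSweet1996] §1 (1.11), (1.15); [MoeglinVignerasWaldspurger1987] Chap. 2 II.1 Rem. (6), II.2; [Rangarao1993]
Lemma 3.2 (3.8).
HONEST LABEL.  Count-neutral helper; it retires nothing by itself: `HC_CM` is proved only modulo the 7 printed citations (2 remaining named inputs: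
hLiu418 = `stmt-HodgeConjecture-24832`, h413 = `stmt-HodgeConjecture-24833`) until rung 0 closes.

## References
* [Kudla1994] S. S. Kudla, Israel J. Math. 87 (1994), §2, §3 Thm. 3.1.
* [HarrisKudlaSweet1996] M. Harris, S. Kudla, W. J. Sweet, J. Amer. Math. Soc. 9 (1996), §1 (1.11), (1.15).
* [MoeglinVignerasWaldspurger1987] C. Mœglin, M.-F. Vignéras, J.-L. Waldspurger, LNM 1291 (1987), Chap. 2 II.1 Rem. (6), II.2.
* [Rangarao1993] R. Ranga Rao, Pacific J. Math. 157 (1993), Lemma 3.2 (3.8).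
-/

set_option autoImplicit false
set_option linter.dupNamespace false -- the mandated namespace repeats `HodgeConjecture.HodgeConjecture`

noncomputable section

open scoped Matrix
open NumberField IsDedekindDomain Matrix
open Literature.RepresentationTheory.HeisenbergGroup Literature.RepresentationTheory.HeisenbergGroup.SymplecticMatrix
open Literature.NumberTheory.Automorphic Literature.NumberTheory.Automorphic.UnitaryGroup
open Literature.NumberTheory.GelbartRogawski1991 Literature.NumberTheory.GelbartRogawski1991.GRConstruction
open Literature.NumberTheory.GelbartRogawski1991.AdaptedBlocks
open Literature.NumberTheory.GelbartRogawski1991.UnitaryDualPair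
open Literature.NumberTheory.GelbartRogawski1991.UnitaryDualPair.LocalSplitting
open Literature.NumberTheory.GelbartRogawski1991.UnitaryDualPair.LocalSplitting.FrameTransport
open Literature.NumberTheory.GelbartRogawski1991.UnitaryDualPair.LocalSplitting.DoubledBlock
open Literature.NumberTheory.K2Lit.SiegelDoubled
open Summit.HodgeConjecture.HodgeConjecture.Cruxes.HLiu418.K2LiuLocalSWSectionDefs
open Summit.HodgeConjecture.HodgeConjecture.Cruxes.HLiu418.K2LiuLocalSWTensorBlockTransport
open Summit.HodgeConjecture.HodgeConjecture.Cruxes.HLiu418.K2LiuTensorMiddleCellPointReading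
open Summit.HodgeConjecture.HodgeConjecture.Cruxes.HLiu418.K2LiuTensorMiddleCellFrameReading

namespace Summit.HodgeConjecture.HodgeConjecture.Cruxes.HLiu418.K2LiuTensorMiddleCellPointRows

/-! ## §1 Pure algebra: single-row readings give coordinate vectors proportional to `e_{i₀}` -/

section Rows

variable {K X : Type*} [Field K]

/-- **SINGLE-ROW READINGS**: with the letter (K1) `![κ₁ x j, κ₂ x j, κ₃ x j] ᵥ* P = R x j` (`P` invertible), if the reading of `z` has row `i₀` equal to `c` and
every other row equal to `0` (`R z j l = if j = i₀ then c l else 0`), then `κ_b z = ((c ᵥ* P⁻¹) b) • e_{i₀}` for `b = 1, 2, 3`. [folklore] -/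
theorem single_rows_of_reading (κ₁ κ₂ κ₃ : X → Fin 2 → K) (P : Matrix (Fin 3) (Fin 3) K) (hP : IsUnit P.det)
    (R : X → Fin 2 → Fin 3 → K) (hK1 : ∀ x j, ![κ₁ x j, κ₂ x j, κ₃ x j] ᵥ* P = R x j)
    {z : X} {i₀ : Fin 2} (c : Fin 3 → K) (hR : ∀ j l, R z j l = if j = i₀ then c l else 0) :
    κ₁ z = ((c ᵥ* P⁻¹) 0) • Pi.single i₀ (1 : K) ∧ κ₂ z = ((c ᵥ* P⁻¹) 1) • Pi.single i₀ (1 : K) ∧ κ₃ z = ((c ᵥ* P⁻¹) 2) • Pi.single i₀ (1 : K) := by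
  have hinv : ∀ j, ![κ₁ z j, κ₂ z j, κ₃ z j] = R z j ᵥ* P⁻¹ := fun j => by
    rw [← hK1 z j, Matrix.vecMul_vecMul, Matrix.mul_nonsing_inv _ hP, Matrix.vecMul_one]
  -- row `i₀` is `c`, row `i₁` is `0`
  have hR₀ : R z i₀ = c := funext fun l => by rw [hR, if_pos rfl]
  have hR₁ : ∀ j, j ≠ i₀ → R z j = 0 := fun j hj => funext fun l => by rw [hR, if_neg hj, Pi.zero_apply]
  have key : ∀ (b : Fin 3) (κ : X → Fin 2 → K), (∀ j, κ z j = (R z j ᵥ* P⁻¹) b) → κ z = ((c ᵥ* P⁻¹) b) • Pi.single i₀ (1 : K) := by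
    intro b κ hκ
    funext j
    rw [hκ j, Pi.smul_apply, Pi.single_apply, smul_eq_mul, mul_ite, mul_one, mul_zero]
    by_cases hj : j = i₀
    · rw [if_pos hj, hj, hR₀]
    · rw [if_neg hj, hR₁ j hj, Matrix.zero_vecMul, Pi.zero_apply]
  refine ⟨key 0 κ₁ fun j => ?_, key 1 κ₂ fun j => ?_, key 2 κ₃ fun j => ?_⟩
  · have h := congrFun (hinv j) 0
    simpa using h
  · have h := congrFun (hinv j) 1
    simpa using h
  · have h := congrFun (hinv j) 2
    simpa using h

end Rows

/-! ## §2 The tensor datum `𝕍 ⊗ V′` (`M₂ = 3`): the `κ`-rows of `PD·(x₁ ⊔ 0)` and of `B⁻¹·PD·(x₁ ⊔ 0)` -/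

section Tensor

variable (L : Type) [Field L] [NumberField L] [IsCMField L]
variable {N M : ℕ} (e : Fin N × Fin M ≃ Fin 2)
  (dV : Fin N → L) (hdV : ∀ i, IsCMField.complexConj L (dV i) = dV i)
  (dW : Fin M → L) (hdW : ∀ i, IsCMField.complexConj L (dW i) = dW i)
variable {M' : ℕ} (eW : Fin M × Fin 3 ≃ Fin M') (e' : Fin N × Fin M' ≃ Fin (3 + 3))
  (dV' : Fin 3 → L) (hdV' : ∀ k, IsCMField.complexConj L (dV' k) = dV' k)
  (v : HeightOneSpectrum (𝓞 (Fp L))) (w₀ : PlacesOver L v)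

/-- **THE `κ`-ROWS OF THE INTEGRATION POINT**: with ★ (C2b′)'s frame letters (`hi hσ₀ hσ₁ P hPσ hP hPD`), a mover `p₁` (`hp₁`), any `p₂`, and the witness letter (K1)
for a frame coordinate `κ` at the implementer of record `E′ := π(frameMp_{PD} j̃(p₁, p₂))` (`P₃` invertible), there is ONE linear homeomorphism
`cX : X₁ ≃L[F_v] (Fin 3 → E ⊗ F_v)` with, for every `x₁ ∈ X₁` and `z := PD·(x₁ ⊔ 0)`:
`(κ z).1 = α • e_{i₀}`, `(κ z).2.1 = β • e_{i₀}`, `(κ z).2.2 = γ • e_{i₀}`, `(α, β, γ) := ((fun l => cX x₁ l w₀) ᵥ* P₃⁻¹) (0, 1, 2)` — the `hz` letter of ★ (C3-c).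
[cite: Kudla1994, §2, §3 Thm. 3.1] [cite: HarrisKudlaSweet1996, §1 (1.11)] [cite: MoeglinVignerasWaldspurger1987, Chap. 2 II.1 Rem. (6)] -/
theorem exists_pointRows {i₀ i₁ : Fin 2} (hi : i₀ ≠ i₁) {σ : Equiv.Perm (Fin (3 + 3))}
    (hσ₀ : ∀ k, σ (epsV e eW e' (i₀, k)) = finSumFinEquiv (Sum.inl k)) (hσ₁ : ∀ k, σ (epsV e eW e' (i₁, k)) = finSumFinEquiv (Sum.inr k))
    {T₁ T₂ : Matrix (Fin 3) (Fin 3) (Fp L)}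
    (P : GL (Fin (3 + 3)) (Fp L)) (hPσ : (P : Matrix (Fin (3 + 3)) (Fin (3 + 3)) (Fp L)) = σ.toPEquiv.toMatrix)
    (hP : ((P : Matrix (Fin (3 + 3)) (Fin (3 + 3)) (Fp L)))ᵀ *
        gramR L e' dV hdV (tensorFrame L dW eW dV') (tensorFrame_real L dW hdW eW dV' hdV') * (P : Matrix _ _ (Fp L)) =
      UnitaryGroup.finSum 3 3 T₁ T₂)
    {PD : GL (Fin ((3 + 3) + (3 + 3))) (Fp L)} (hPD : PD = UnitaryGroup.reindexGL (e₂ (3 + 3)) (UnitaryGroup.blockDiagGL (P, P)))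
    (p₁ : LocalMp (Fp L) (3 + 3) (gramD (Fp L) 3 T₁) v)
    (hp₁ : (deltaLagrangian (Fp L) v 3).map (toLin (Fp L) v (MpPsi.proj _ p₁)) = lagrangianY (Fp L) (3 + 3) v)
    (p₂ : LocalMp (Fp L) (3 + 3) (gramD (Fp L) 3 T₂) v)
    (P₃ : Matrix (Fin 3) (Fin 3) (w₀.1.adicCompletion L)) (hP₃ : IsUnit P₃.det)
    (κ : (Fin ((3 + 3) + (3 + 3)) → v.adicCompletion (Fp L)) ≃+
      ((Fin 2 → w₀.1.adicCompletion L) × (Fin 2 → w₀.1.adicCompletion L) × (Fin 2 → w₀.1.adicCompletion L)))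
    (hK1 : ∀ (x : Fin ((3 + 3) + (3 + 3)) → v.adicCompletion (Fp L)) (j : Fin 2), ![(κ x).1 j, (κ x).2.1 j, (κ x).2.2 j] ᵥ* P₃ = fun l =>
      halfDiff ((eD (Fp L) L (IsCMField.complexConj L) (complexConj_imagUnit L) (imagUnit_ne_zero L) (imagUnit_mul_self L) v (3 + 3)).symm
        (toLin (Fp L) v (MpPsi.proj _ (frameMp (Fp L) v ((3 + 3) + (3 + 3)) PD (transpose_pd_mul_gramD_mul_pd (Fp L) (3 + 3) P hP hPD)
          (boxLoc (Fp L) v 3 3 (T₁ := T₁) (T₂ := T₂) (p₁, p₂))))⁻¹ (x, 0))) (epsV e eW e' (j, l)) w₀) :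
    ∃ cX : (Fin (3 + 3) → v.adicCompletion (Fp L)) ≃L[v.adicCompletion (Fp L)] (Fin 3 → LocalRing L v),
      ∀ x₁ : Fin (3 + 3) → v.adicCompletion (Fp L),
        (κ (frameLin (Fp L) v ((3 + 3) + (3 + 3)) PD (glue (blkIdx 3 3) x₁ 0))).1 =
            (((fun l => cX x₁ l w₀) ᵥ* P₃⁻¹) 0) • Pi.single i₀ (1 : w₀.1.adicCompletion L) ∧
          (κ (frameLin (Fp L) v ((3 + 3) + (3 + 3)) PD (glue (blkIdx 3 3) x₁ 0))).2.1 =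
            (((fun l => cX x₁ l w₀) ᵥ* P₃⁻¹) 1) • Pi.single i₀ (1 : w₀.1.adicCompletion L) ∧
          (κ (frameLin (Fp L) v ((3 + 3) + (3 + 3)) PD (glue (blkIdx 3 3) x₁ 0))).2.2 =
            (((fun l => cX x₁ l w₀) ᵥ* P₃⁻¹) 2) • Pi.single i₀ (1 : w₀.1.adicCompletion L) := by
  obtain ⟨cX, hcX⟩ := exists_pointReading L e dV hdV dW hdW eW e' dV' hdV' v hi hσ₀ hσ₁ P hPσ hP hPD p₁ hp₁ p₂
  refine ⟨cX, fun x₁ => ?_⟩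
  exact single_rows_of_reading (fun x => (κ x).1) (fun x => (κ x).2.1) (fun x => (κ x).2.2) P₃ hP₃ _ (fun x j => hK1 x j)
    (fun l => cX x₁ l w₀) fun j l => by
      rw [hcX x₁ j l]
      split_ifs <;> rfl

set_option maxHeartbeats 800000 in -- the `MpPsi`∕`frameMp` letters in ★ (C3-c)'s binders unify slowly (as ★ (C3) §1)
/-- **THE `κ`-ROWS OF THE LEVI TRANSLATE OF THE INTEGRATION POINT** (§2 ∘ ★ (C3-c) `kappa_inv_levi_of_single_row`): with the same `cX`, for every Siegel `k ∈ P_Δ(U(𝕍□)_v)`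
and every `B` with the Levi letter `hB : E′·ι′(k ⊗ 1)·E′⁻¹ = transportSp 𝕋′ (m(B))` (★ (C3-b) p862528 for `k ∈ M_Δ`),
`(κ (B⁻¹ · PD·(x₁ ⊔ 0))).1 = fun j => α(x₁) · (blkD (matA k⁻¹) j i₀)(w₀)`, `.2.1` with `β(x₁)`, `.2.2` with `γ(x₁)` — the Levi-row shape `(α·a, β·a, γ·a)` with
`a j := (blkD (matA k⁻¹) j i₀)(w₀)` of ★ (M2a-L)ϖ and of F0P2-p07's `K2LiuNonsplitMiddleProfileRow`.
[cite: Kudla1994, §3 Thm. 3.1] [cite: HarrisKudlaSweet1996, §1 (1.11), (1.15)] [cite: MoeglinVignerasWaldspurger1987, Chap. 2 II.2] [cite: Rangarao1993, Lemma 3.2 (3.8)] -/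
theorem exists_pointRows_levi {i₀ i₁ : Fin 2} (hi : i₀ ≠ i₁) {σ : Equiv.Perm (Fin (3 + 3))}
    (hσ₀ : ∀ k, σ (epsV e eW e' (i₀, k)) = finSumFinEquiv (Sum.inl k)) (hσ₁ : ∀ k, σ (epsV e eW e' (i₁, k)) = finSumFinEquiv (Sum.inr k))
    {T₁ T₂ : Matrix (Fin 3) (Fin 3) (Fp L)}
    (P : GL (Fin (3 + 3)) (Fp L)) (hPσ : (P : Matrix (Fin (3 + 3)) (Fin (3 + 3)) (Fp L)) = σ.toPEquiv.toMatrix)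
    (hP : ((P : Matrix (Fin (3 + 3)) (Fin (3 + 3)) (Fp L)))ᵀ *
        gramR L e' dV hdV (tensorFrame L dW eW dV') (tensorFrame_real L dW hdW eW dV' hdV') * (P : Matrix _ _ (Fp L)) =
      UnitaryGroup.finSum 3 3 T₁ T₂)
    (hT₀d : IsUnit (gramR L e' dV hdV (tensorFrame L dW eW dV') (tensorFrame_real L dW hdW eW dV' hdV')).det)
    {PD : GL (Fin ((3 + 3) + (3 + 3))) (Fp L)} (hPD : PD = UnitaryGroup.reindexGL (e₂ (3 + 3)) (UnitaryGroup.blockDiagGL (P, P)))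
    (p₁ : LocalMp (Fp L) (3 + 3) (gramD (Fp L) 3 T₁) v)
    (hp₁ : (deltaLagrangian (Fp L) v 3).map (toLin (Fp L) v (MpPsi.proj _ p₁)) = lagrangianY (Fp L) (3 + 3) v)
    (p₂ : LocalMp (Fp L) (3 + 3) (gramD (Fp L) 3 T₂) v)
    (P₃ : Matrix (Fin 3) (Fin 3) (w₀.1.adicCompletion L)) (hP₃ : IsUnit P₃.det)
    (κ : (Fin ((3 + 3) + (3 + 3)) → v.adicCompletion (Fp L)) ≃+
      ((Fin 2 → w₀.1.adicCompletion L) × (Fin 2 → w₀.1.adicCompletion L) × (Fin 2 → w₀.1.adicCompletion L)))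
    (hK1 : ∀ (x : Fin ((3 + 3) + (3 + 3)) → v.adicCompletion (Fp L)) (j : Fin 2), ![(κ x).1 j, (κ x).2.1 j, (κ x).2.2 j] ᵥ* P₃ = fun l =>
      halfDiff ((eD (Fp L) L (IsCMField.complexConj L) (complexConj_imagUnit L) (imagUnit_ne_zero L) (imagUnit_mul_self L) v (3 + 3)).symm
        (toLin (Fp L) v (MpPsi.proj _ (frameMp (Fp L) v ((3 + 3) + (3 + 3)) PD (transpose_pd_mul_gramD_mul_pd (Fp L) (3 + 3) P hP hPD)
          (boxLoc (Fp L) v 3 3 (T₁ := T₁) (T₂ := T₂) (p₁, p₂))))⁻¹ (x, 0))) (epsV e eW e' (j, l)) w₀) :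
    ∃ cX : (Fin (3 + 3) → v.adicCompletion (Fp L)) ≃L[v.adicCompletion (Fp L)] (Fin 3 → LocalRing L v),
      ∀ (x₁ : Fin (3 + 3) → v.adicCompletion (Fp L))
        (k : UnitaryGroup.localPi L (IsCMField.complexConj L) (2 + 2) (hermD L e dV hdV dW hdW) v)
        (_hk : IsSiegelDelta (Fp L) L (IsCMField.complexConj L) (complexConj_imagUnit L) (imagUnit_ne_zero L) (imagUnit_mul_self L) v 2
          (gramR_isSymm L e dV hdV dW hdW) (hermD_eq_map_gramD L e dV hdV dW hdW) k)
        (B : GL (Fin ((3 + 3) + (3 + 3))) (v.adicCompletion (Fp L)))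
        (_hB : MpPsi.proj _ (frameMp (Fp L) v ((3 + 3) + (3 + 3)) PD (transpose_pd_mul_gramD_mul_pd (Fp L) (3 + 3) P hP hPD)
              (boxLoc (Fp L) v 3 3 (T₁ := T₁) (T₂ := T₂) (p₁, p₂))) *
            iotaD (Fp L) L (IsCMField.complexConj L) (complexConj_imagUnit L) (imagUnit_ne_zero L) (imagUnit_mul_self L) v (3 + 3)
              (gramR_isSymm L e' dV hdV (tensorFrame L dW eW dV') (tensorFrame_real L dW hdW eW dV' hdV'))
              (hermD_eq_map_gramD L e' dV hdV (tensorFrame L dW eW dV') (tensorFrame_real L dW hdW eW dV' hdV'))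
              (tensorEmbLoc L e dV hdV dW hdW eW e' dV' hdV' v k) *
            (MpPsi.proj _ (frameMp (Fp L) v ((3 + 3) + (3 + 3)) PD (transpose_pd_mul_gramD_mul_pd (Fp L) (3 + 3) P hP hPD)
              (boxLoc (Fp L) v 3 3 (T₁ := T₁) (T₂ := T₂) (p₁, p₂))))⁻¹ =
          transportSp (localGram (Fp L) ((3 + 3) + (3 + 3))
              (gramD (Fp L) (3 + 3) (gramR L e' dV hdV (tensorFrame L dW eW dV') (tensorFrame_real L dW hdW eW dV' hdV'))) v)
            (isUnit_det_localGram_gramD (Fp L) v (3 + 3) hT₀d) (levi B)),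
        (κ (((B⁻¹ : GL (Fin ((3 + 3) + (3 + 3))) (v.adicCompletion (Fp L))) : Matrix (Fin ((3 + 3) + (3 + 3))) (Fin ((3 + 3) + (3 + 3))) (v.adicCompletion (Fp L))) *ᵥ
              frameLin (Fp L) v ((3 + 3) + (3 + 3)) PD (glue (blkIdx 3 3) x₁ 0))).1 =
            (fun j => (((fun l => cX x₁ l w₀) ᵥ* P₃⁻¹) 0) * (blkD (matA (Fp L) L (IsCMField.complexConj L) v 2 k⁻¹) j i₀) w₀) ∧
          (κ (((B⁻¹ : GL (Fin ((3 + 3) + (3 + 3))) (v.adicCompletion (Fp L))) : Matrix (Fin ((3 + 3) + (3 + 3))) (Fin ((3 + 3) + (3 + 3))) (v.adicCompletion (Fp L))) *ᵥ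
              frameLin (Fp L) v ((3 + 3) + (3 + 3)) PD (glue (blkIdx 3 3) x₁ 0))).2.1 =
            (fun j => (((fun l => cX x₁ l w₀) ᵥ* P₃⁻¹) 1) * (blkD (matA (Fp L) L (IsCMField.complexConj L) v 2 k⁻¹) j i₀) w₀) ∧
          (κ (((B⁻¹ : GL (Fin ((3 + 3) + (3 + 3))) (v.adicCompletion (Fp L))) : Matrix (Fin ((3 + 3) + (3 + 3))) (Fin ((3 + 3) + (3 + 3))) (v.adicCompletion (Fp L))) *ᵥ
              frameLin (Fp L) v ((3 + 3) + (3 + 3)) PD (glue (blkIdx 3 3) x₁ 0))).2.2 =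
            (fun j => (((fun l => cX x₁ l w₀) ᵥ* P₃⁻¹) 2) * (blkD (matA (Fp L) L (IsCMField.complexConj L) v 2 k⁻¹) j i₀) w₀) := by
  obtain ⟨cX, hcX⟩ := exists_pointRows L e dV hdV dW hdW eW e' dV' hdV' v w₀ hi hσ₀ hσ₁ P hPσ hP hPD p₁ hp₁ p₂ P₃ hP₃ κ hK1
  refine ⟨cX, fun x₁ k hk B hB => ?_⟩
  exact kappa_inv_levi_of_single_row L e dV hdV dW hdW eW e' dV' hdV' v w₀ (isUnit_det_localGram_gramD (Fp L) v (3 + 3) hT₀d) _ P₃ hP₃ κ hK1 k hk B hB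
    _ i₀ _ _ _ (hcX x₁)

end Tensor

end Summit.HodgeConjecture.HodgeConjecture.Cruxes.HLiu418.K2LiuTensorMiddleCellPointRows

end
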